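import Mathlib
import Summits.NavierStokesRegularity.NavierStokesRegularity.Theorems.EulerZoomLiouvillePowerGaugeEulerLiouvilleLastExitLateReturnsTools
import HarnessLib

/-!
# Line `last_exit` (ns-idea-11 g8), stub LE2b `stub_lateReturnsVanish`: UNDER NO FAR HOVERING, LATE RETURNS TO THE NEAR BALL ARE RARE
# (crux `EulerZoomLiouville.PowerGaugeEulerLiouville` = stmt-NavierStokesRegularity-19832; class-free measure bookkeeping; width seat ns-ezl-w3 g6, plan of ns-ezl-w1 g6)

Route №10 `EulerZoomLiouville` (NavierStokesRegularity), crux E; line `Cruxes/PowerGaugeEulerLiouville/Lines/last_exit.lean` (LINE g8-2), the last provable stub.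
`(V, P′)` a `C²` self-similar Euler profile at rate `γ = 1/(2+ρ)`, `0 < ρ ≤ ½`, `W = γy + V`, `ℋ` its Bernoulli function; NO FAR HOVERING above `h` beyond `R₁`
with floor `w₀ > 0`.  THEN (`LastExit.lateReturnsVanish` = the line's `LateReturnsVanish` VERBATIM, `NoFarHovering` unfolded; and `LastExit.lateReturnsVanish_of` =
`Sig.stub_lateReturnsVanish` = «LE2a ⇒ LateReturnsVanish»): around every vortical `x₀ ∈ {ℋ > h}` there is a ball `B ⊆ {curl V ≠ 0} ∩ {ℋ > h}` such that
for every `ε > 0` and all late times `S ≥ S₀(ε)`, UNIFORMLY in `R` and in the `C²` globally Lipschitz cut-off copy `V′` of `V` on `ball 0 R_big ⊋ B̄(0,2R)`, the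
labels of `B` whose backward `W_{V′}`-orbit stays in `B̄(0,2R)` up to some time `σ ≥ S` at which it is in `B(0,R₁)` weigh at most `ε·vol(B)`.

PROOF (ns-ezl-w1 g6's plan, HOME/ns-ezl-w1/LE2b-PLAN-g6.md).  (1) Reference cut-offs `V_m` (`Loc.exists_cutoff_local` at `m + 1`, `m : ℕ`) and their backward
flows `Arc m y t`.  (2) R-INDEPENDENT DECREASING MEASURABLE SUPERSETS `B n = B ∩ {y | ∃ m q, q ≥ n+1, ‖Arc m y‖ ≤ m on [0,q], ‖Arc m y q‖ ≤ R₁+1}` (countable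
union of closed sets).  (3) INCLUSION for `S ≥ n + 1 + δ`: the `V′`-orbit is a true arc on `[0,σ]`, hence THE `V_m`-arc for `m = ⌈2R⌉₊`
(`LastExit.eqOn_arcs_of_cutoff`); the WINDOW LEMMA (`LastExit.norm_le_of_return_window`, speed bound `v` on `B̄(0,R₁+1)`, `δ = 1/(v+1)`) keeps it in `B̄(0,R₁+1)`
on `[σ−δ, σ]`, which contains a rational `q ≥ n + 1`.  (4) NULL INTERSECTION: a label in every `B n` carries arcs `Arc (m n) y` on `[0, q n]`, `q n → ∞`, pairwise
equal on common intervals (uniqueness under the LARGER cut-off), which PATCH to a global backward `W`-orbit returning below `R₁ + 2` cofinally — BOUNDED by LE2a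
(`LastExit.cofinalReturnerBounded`), so the label lies in W3b's null set `Loc.volume_vortical_boundedBackward_eq_zero`.  (5) Continuity of the measure from above.

WHAT THIS IS NOT: not NS regularity, not the crux E, not the line's faces — class-free bookkeeping on `C²` profiles (MODEL lattice), `--supports` stmt-19832;
19832 OPEN. [folklore]
-/

noncomputable section

-- flat `Theorems/<Route><Decl>…` files of one crux share the namespace of the crux (tree convention: `Summit.<S>.<S>.…`)
set_option linter.dupNamespace false

open Set Filter Topology Metric MeasureTheory
open scoped RealInnerProductSpace ENNReal

namespace Summit.NavierStokesRegularity.NavierStokesRegularity.Theorems.PowerGaugeEulerLiouville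

namespace LastExit

open Literature.Analysis Literature.Analysis.FluidPDE
open ChannelClock

/-- **LE2b content `LateReturnsVanish` OF LINE `last_exit`** (the line's `LateReturnsVanish` VERBATIM with `NoFarHovering` unfolded; Literature names, `E3`
spelled out): under no far hovering above `h`, late returns of the labels of a small vortical high ball to `B(0,R₁)` — while staying in `B̄(0,2R)` — are rare,
uniformly in `R` and in the cut-off copy.  Proof in the module docstring. [folklore] -/
theorem lateReturnsVanish :
    ∀ ρ : ℝ, 0 < ρ → ρ ≤ 1 / 2 →
    ∀ (V : EuclideanSpace ℝ (Fin 3) → EuclideanSpace ℝ (Fin 3)) (P' : EuclideanSpace ℝ (Fin 3) → ℝ), ContDiff ℝ 2 V →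
      IsSelfSimilarEulerProfile (1 / (2 + ρ)) 0 V P' →
      ∀ (h w₀ R₁ : ℝ), 0 < w₀ →
        (∀ y : EuclideanSpace ℝ (Fin 3), R₁ ≤ ‖y‖ →
          h < selfSimilarBernoulli (1 / (2 + ρ)) 0 V P' y → curl V y ≠ 0 →
            w₀ ≤ ‖selfSimilarTransport (1 / (2 + ρ)) 0 V y‖) →
      ∀ x₀ : EuclideanSpace ℝ (Fin 3), curl V x₀ ≠ 0 →
        h < selfSimilarBernoulli (1 / (2 + ρ)) 0 V P' x₀ →
        ∃ r : ℝ, 0 < r ∧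
          Metric.ball x₀ r ⊆ {y | curl V y ≠ 0 ∧ h < selfSimilarBernoulli (1 / (2 + ρ)) 0 V P' y} ∧
          ∀ ε : ℝ, 0 < ε → ∃ S₀ : ℝ, ∀ (S R : ℝ), S₀ ≤ S →
            ∀ (V' : EuclideanSpace ℝ (Fin 3) → EuclideanSpace ℝ (Fin 3)) (K Rbig : ℝ), ContDiff ℝ 2 V' →
              (∀ y, ‖fderiv ℝ V' y‖ ≤ K) → 2 * R < Rbig →
              (∀ w ∈ Metric.ball (0 : EuclideanSpace ℝ (Fin 3)) Rbig, V' w = V w) →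
              (volume (Metric.ball x₀ r ∩ {y | ∃ σ : ℝ, S ≤ σ ∧
                  (∀ σ' ∈ Set.Icc 0 σ,
                    ‖ODE.evolutionMap (fun _ : ℝ => selfSimilarTransport (1 / (2 + ρ)) 0 V') 0 (-σ') y‖ ≤ 2 * R) ∧
                  ‖ODE.evolutionMap (fun _ : ℝ => selfSimilarTransport (1 / (2 + ρ)) 0 V') 0 (-σ) y‖ < R₁})).toReal ≤
                ε * (volume (Metric.ball x₀ r)).toReal := by
  intro ρ hρ hρh V P' hV2 hprof h w₀ R₁ hw₀ hNFH x₀ hx₀c hx₀H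
  set γ : ℝ := 1 / (2 + ρ) with hγdef
  have h2ρ : (0 : ℝ) < 2 + ρ := by linarith
  have hγ : 0 < γ := one_div_pos.2 h2ρ
  have hγ2 : γ < 1 / 2 := one_div_lt_one_div_of_lt two_pos (by linarith)
  set W : EuclideanSpace ℝ (Fin 3) → EuclideanSpace ℝ (Fin 3) := selfSimilarTransport γ 0 V with hWdef
  set ℋ : EuclideanSpace ℝ (Fin 3) → ℝ := selfSimilarBernoulli γ 0 V P' with hHdef
  have hWc : Continuous W := by
    have e : W = fun y => γ • (y - 0) + V y := rfl
    rw [e]; exact ((continuous_id.sub continuous_const).const_smul γ).add hV2.continuous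
  have hHc : Continuous ℋ := hprof.contDiff_selfSimilarBernoulli.continuous
  have hcurlc : Continuous (curl V) := (differentiable_curl_of_contDiff hV2).continuous
  -- ### the blob
  have hOopen : IsOpen {y : EuclideanSpace ℝ (Fin 3) | curl V y ≠ 0 ∧ h < ℋ y} :=
    (isOpen_ne_fun hcurlc continuous_const).inter (isOpen_lt continuous_const hHc)
  obtain ⟨r, hr, hball⟩ := Metric.isOpen_iff.1 hOopen x₀ ⟨hx₀c, hx₀H⟩
  refine ⟨r, hr, hball, fun ε hε => ?_⟩
  -- ### reference cut-offs `V_m` and their backward flows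
  have hcut : ∀ m : ℕ, ∃ Vm : EuclideanSpace ℝ (Fin 3) → EuclideanSpace ℝ (Fin 3), ∃ Km : ℝ,
      ContDiff ℝ 2 Vm ∧ (∀ y, ‖fderiv ℝ Vm y‖ ≤ Km) ∧ ∀ y ∈ ball (0 : EuclideanSpace ℝ (Fin 3)) ((m : ℝ) + 1), Vm y = V y := by
    intro m
    obtain ⟨Vm, hVm, -, -, ⟨Km, hKm⟩, hag⟩ := Loc.exists_cutoff_local hV2 (R := (m : ℝ) + 1) (by positivity)
    exact ⟨Vm, Km, hVm, hKm, hag⟩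
  choose Vc Kc hVc hKc hagc using hcut
  have hVc1 : ∀ m, ContDiff ℝ 1 (Vc m) := fun m => (hVc m).of_le (by norm_num)
  have hWm_eq : ∀ (m : ℕ) (z : EuclideanSpace ℝ (Fin 3)), ‖z‖ < (m : ℝ) + 1 → selfSimilarTransport γ 0 (Vc m) z = W z := by
    intro m z hz
    simp only [hWdef, selfSimilarTransport_apply, hagc m z (by rwa [mem_ball, dist_zero_right])]
  set Arc : ℕ → EuclideanSpace ℝ (Fin 3) → ℝ → EuclideanSpace ℝ (Fin 3) := fun m y t =>
    ODE.evolutionMap (fun _ : ℝ => selfSimilarTransport γ 0 (Vc m)) 0 (-t) y with hArcdef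
  have hArc_d : ∀ m y t, HasDerivAt (Arc m y) ((-1 : ℝ) • selfSimilarTransport γ 0 (Vc m) (Arc m y t)) t :=
    fun m y t => C2.Kelvin.hasDerivAt_flow_neg (γ := γ) (hVc1 m) (hKc m) y t
  have hArc_self : ∀ m y t, HasDerivAt (Arc m y) (-(selfSimilarTransport γ 0 (Vc m) (Arc m y t))) t := fun m y t => by
    have hd := hArc_d m y t
    rwa [neg_one_smul] at hd
  have hArc0 : ∀ m y, Arc m y 0 = y := by intro m y; simp [hArcdef, ODE.evolutionMap_self]
  have hArc_cont : ∀ (m : ℕ) (t : ℝ), Continuous fun y => Arc m y t := fun m t =>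
    (C2.Kelvin.contDiff_flow (γ := γ) (hVc m) (hKc m) (-t)).continuous
  -- a true `W`-arc while it stays in `‖·‖ ≤ m`
  have hArc_true : ∀ (m : ℕ) (y : EuclideanSpace ℝ (Fin 3)) (σ : ℝ), (∀ s ∈ Icc 0 σ, ‖Arc m y s‖ ≤ (m : ℝ)) →
      ∀ s ∈ Icc 0 σ, HasDerivAt (Arc m y) (-(W (Arc m y s))) s := by
    intro m y σ hstay s hs
    have hd := hArc_self m y s
    rw [hWm_eq m _ (by linarith [hstay s hs])] at hd
    exact hd
  -- ### speed bound near the return ball and the window length `δ`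
  obtain ⟨v₁, hv₁⟩ := (isCompact_closedBall (0 : EuclideanSpace ℝ (Fin 3)) (R₁ + 1)).exists_bound_of_continuousOn hWc.continuousOn
  set v : ℝ := max v₁ 0 with hvdef
  have hv : ∀ z : EuclideanSpace ℝ (Fin 3), ‖z‖ ≤ R₁ + 1 → ‖W z‖ ≤ v := fun z hz =>
    (hv₁ z (mem_closedBall_zero_iff.2 hz)).trans (le_max_left _ _)
  have hv0 : 0 ≤ v := le_max_right _ _
  set δ : ℝ := 1 / (v + 1) with hδdef
  have hδ : 0 < δ := by rw [hδdef]; positivity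
  have hvδ : v * δ < 1 := by
    rw [hδdef, mul_one_div, div_lt_one (by linarith)]; linarith
  -- ### the R-independent decreasing measurable supersets
  set Bn : ℕ → Set (EuclideanSpace ℝ (Fin 3)) := fun n => ball x₀ r ∩ {y | ∃ m : ℕ, ∃ q : ℚ, (n : ℝ) + 1 ≤ (q : ℝ) ∧
      (∀ s ∈ Icc (0 : ℝ) (q : ℝ), ‖Arc m y s‖ ≤ (m : ℝ)) ∧ ‖Arc m y q‖ ≤ R₁ + 1} with hBndef
  have hBn_meas : ∀ n, MeasurableSet (Bn n) := by
    intro n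
    refine measurableSet_ball.inter ?_
    have e : {y : EuclideanSpace ℝ (Fin 3) | ∃ m : ℕ, ∃ q : ℚ, (n : ℝ) + 1 ≤ (q : ℝ) ∧
        (∀ s ∈ Icc (0 : ℝ) (q : ℝ), ‖Arc m y s‖ ≤ (m : ℝ)) ∧ ‖Arc m y q‖ ≤ R₁ + 1} =
        ⋃ m : ℕ, ⋃ q : ℚ, {y | (n : ℝ) + 1 ≤ (q : ℝ) ∧ (∀ s ∈ Icc (0 : ℝ) (q : ℝ), ‖Arc m y s‖ ≤ (m : ℝ)) ∧ ‖Arc m y q‖ ≤ R₁ + 1} := by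
      ext y; simp only [mem_setOf_eq, mem_iUnion]
    rw [e]
    refine MeasurableSet.iUnion fun m => MeasurableSet.iUnion fun q => ?_
    by_cases hq : (n : ℝ) + 1 ≤ (q : ℝ)
    · have e2 : {y : EuclideanSpace ℝ (Fin 3) | (n : ℝ) + 1 ≤ (q : ℝ) ∧ (∀ s ∈ Icc (0 : ℝ) (q : ℝ), ‖Arc m y s‖ ≤ (m : ℝ)) ∧
          ‖Arc m y q‖ ≤ R₁ + 1} =
          (⋂ s ∈ Icc (0 : ℝ) (q : ℝ), {y | ‖Arc m y s‖ ≤ (m : ℝ)}) ∩ {y | ‖Arc m y q‖ ≤ R₁ + 1} := by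
        ext y
        simp only [mem_setOf_eq, hq, true_and, mem_inter_iff, mem_iInter]
      rw [e2]
      exact ((isClosed_biInter fun s _ => isClosed_le (hArc_cont m s).norm continuous_const).inter
        (isClosed_le (hArc_cont m q).norm continuous_const)).measurableSet
    · have e2 : {y : EuclideanSpace ℝ (Fin 3) | (n : ℝ) + 1 ≤ (q : ℝ) ∧ (∀ s ∈ Icc (0 : ℝ) (q : ℝ), ‖Arc m y s‖ ≤ (m : ℝ)) ∧
          ‖Arc m y q‖ ≤ R₁ + 1} = ∅ := by
        ext y; simp only [mem_setOf_eq, hq, false_and, mem_empty_iff_false]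
      rw [e2]; exact MeasurableSet.empty
  have hBn_anti : Antitone Bn := by
    intro n n' hnn' y hy
    obtain ⟨hyB, m, q, hq, hstay, hret⟩ := hy
    have hcast : (n : ℝ) ≤ (n' : ℝ) := by exact_mod_cast hnn'
    exact ⟨hyB, m, q, by linarith, hstay, hret⟩
  -- ### the intersection is W3b-null: patch the arcs to a bounded global orbit
  have hInter_null : volume (⋂ n, Bn n) = 0 := by
    refine measure_mono_null ?_ (Loc.volume_vortical_boundedBackward_eq_zero hprof hγ hγ2)
    intro y hy
    rw [mem_iInter] at hy
    have hyB : y ∈ ball x₀ r := (hy 0).1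
    have hyc : curl V y ≠ 0 := (hball hyB).1
    have hyH : h < ℋ y := (hball hyB).2
    have hch : ∀ n : ℕ, ∃ m : ℕ, ∃ q : ℚ, (n : ℝ) + 1 ≤ (q : ℝ) ∧
        (∀ s ∈ Icc (0 : ℝ) (q : ℝ), ‖Arc m y s‖ ≤ (m : ℝ)) ∧ ‖Arc m y q‖ ≤ R₁ + 1 := fun n => (hy n).2
    choose mI qI hqI hstayI hretI using hch
    -- arcs with a smaller cut-off solve the ODE of a larger cut-off
    have hsolve : ∀ i j : ℕ, mI i ≤ mI j → ∀ s ∈ Icc (0 : ℝ) (qI i : ℝ),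
        HasDerivAt (Arc (mI i) y) (-(selfSimilarTransport γ 0 (Vc (mI j)) (Arc (mI i) y s))) s := by
      intro i j hij s hs
      have hd := hArc_true (mI i) y (qI i) (hstayI i) s hs
      have hcast : ((mI i : ℕ) : ℝ) ≤ ((mI j : ℕ) : ℝ) := by exact_mod_cast hij
      rw [← hWm_eq (mI j) _ (by linarith [hstayI i s hs])] at hd
      exact hd
    -- Claim A: all the arcs agree on common intervals
    have hagree : ∀ i j : ℕ, ∀ s ∈ Icc (0 : ℝ) (min (qI i : ℝ) (qI j)), Arc (mI i) y s = Arc (mI j) y s := by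
      intro i j s hs
      rcases le_total (mI i) (mI j) with hij | hji
      · exact eqOn_arcs_of_cutoff (hVc1 (mI j)) (hKc (mI j)) (σ := min (qI i : ℝ) (qI j))
          (fun s hs => hsolve i j hij s ⟨hs.1, hs.2.trans (min_le_left _ _)⟩) (fun s _ => hArc_self (mI j) y s)
          (by rw [hArc0, hArc0]) hs
      · exact eqOn_arcs_of_cutoff (hVc1 (mI i)) (hKc (mI i)) (σ := min (qI i : ℝ) (qI j))
          (fun s _ => hArc_self (mI i) y s) (fun s hs => hsolve j i hji s ⟨hs.1, hs.2.trans (min_le_right _ _)⟩)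
          (by rw [hArc0, hArc0]) hs
    -- the patched orbit
    set Y : ℝ → EuclideanSpace ℝ (Fin 3) := fun t => Arc (mI ⌈t⌉₊) y t with hYdef
    have hYeq : ∀ (n : ℕ) (s : ℝ), 0 ≤ s → s < (n : ℝ) + 1 → Y s = Arc (mI n) y s := by
      intro n s hs0 hsn
      show Arc (mI ⌈s⌉₊) y s = Arc (mI n) y s
      refine hagree ⌈s⌉₊ n s ⟨hs0, le_min ?_ ?_⟩
      · have h1 := hqI ⌈s⌉₊
        have h2 : s ≤ (⌈s⌉₊ : ℝ) := Nat.le_ceil s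
        linarith
      · linarith [hqI n]
    have hY0 : Y 0 = y := by rw [hYeq 0 0 le_rfl (by norm_num), hArc0]
    have hYd : ∀ t : ℝ, 0 ≤ t → HasDerivAt Y ((-1 : ℝ) • selfSimilarTransport γ 0 V (Y t)) t := by
      intro t ht
      set n : ℕ := ⌈t⌉₊ with hndef
      have htn : t ≤ (n : ℝ) := Nat.le_ceil t
      have hev : Y =ᶠ[𝓝 t] Arc (mI n) y := by
        rcases eq_or_lt_of_le ht with h0 | hpos
        · have hn0 : n = 0 := by rw [hndef, ← h0]; simp
          filter_upwards [Iio_mem_nhds (show t < (n : ℝ) + 1 by linarith)] with s hs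
          by_cases hs0 : 0 ≤ s
          · exact hYeq n s hs0 hs
          · push Not at hs0
            show Arc (mI ⌈s⌉₊) y s = Arc (mI n) y s
            rw [Nat.ceil_eq_zero.2 hs0.le, hn0]
        · filter_upwards [Ioo_mem_nhds hpos (show t < (n : ℝ) + 1 by linarith)] with s hs
          exact hYeq n s hs.1.le hs.2
      have hd := hArc_d (mI n) y t
      have htq : t ∈ Icc (0 : ℝ) (qI n : ℝ) := ⟨ht, by linarith [hqI n]⟩
      rw [hWm_eq (mI n) _ (by linarith [hstayI n t htq])] at hd
      have hYt : Y t = Arc (mI n) y t := hYeq n t ht (by linarith)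
      rw [← hYt] at hd
      exact hd.congr_of_eventuallyEq hev
    -- cofinal returns below `R₁ + 2`
    have hcof : ∀ S' : ℝ, ∃ t : ℝ, S' ≤ t ∧ ‖Y t‖ < R₁ + 2 := by
      intro S'
      set n : ℕ := ⌈max S' 0⌉₊ with hndef
      refine ⟨qI n, ?_, ?_⟩
      · have h1 : max S' 0 ≤ (n : ℝ) := Nat.le_ceil _
        linarith [le_max_left S' 0, hqI n]
      · have hq0 : (0 : ℝ) ≤ (qI n : ℝ) := by linarith [hqI n]
        show ‖Arc (mI ⌈((qI n : ℚ) : ℝ)⌉₊) y (qI n)‖ < R₁ + 2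
        have hs : ((qI n : ℚ) : ℝ) ∈ Icc (0 : ℝ) (min (qI ⌈((qI n : ℚ) : ℝ)⌉₊ : ℝ) (qI n)) := by
          refine ⟨hq0, le_min ?_ le_rfl⟩
          have h1 := hqI ⌈((qI n : ℚ) : ℝ)⌉₊
          have h2 : ((qI n : ℚ) : ℝ) ≤ (⌈((qI n : ℚ) : ℝ)⌉₊ : ℝ) := Nat.le_ceil _
          linarith
        rw [hagree _ n _ hs]
        linarith [hretI n]
    -- LE2a at threshold `R₁ + 2`
    have hNFH2 : ∀ z : EuclideanSpace ℝ (Fin 3), R₁ + 2 ≤ ‖z‖ → h < selfSimilarBernoulli γ 0 V P' z → curl V z ≠ 0 →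
        w₀ ≤ ‖selfSimilarTransport γ 0 V z‖ := fun z hz => hNFH z (by linarith)
    obtain ⟨N, hN⟩ := cofinalReturnerBounded ρ hρ hρh V P' hV2 hprof h w₀ (R₁ + 2) hw₀ hNFH2 Y hYd
      (by rw [hY0]; exact hyc) (by rw [hY0]; exact hyH) hcof
    exact ⟨hyc, Y, hY0, hYd, N, hN⟩
  -- ### continuity of the measure from above
  have hvpos : 0 < volume (ball x₀ r) := measure_ball_pos volume x₀ hr
  have hvtop : volume (ball x₀ r) < ∞ := measure_ball_lt_top
  have htend : Tendsto (volume ∘ Bn) atTop (𝓝 0) := by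
    rw [← hInter_null]
    exact tendsto_measure_iInter_atTop (fun n => (hBn_meas n).nullMeasurableSet) hBn_anti
      ⟨0, ((measure_mono inter_subset_left).trans_lt hvtop).ne⟩
  have htarget : (0 : ℝ≥0∞) < ENNReal.ofReal ε * volume (ball x₀ r) :=
    ENNReal.mul_pos (ENNReal.ofReal_pos.2 hε).ne' hvpos.ne'
  obtain ⟨n₀, hn₀⟩ := (htend.eventually (ge_mem_nhds htarget)).exists
  refine ⟨(n₀ : ℝ) + 1 + δ, fun S R hS V' K Rbig hV' hK' hRbig hagree' => ?_⟩
  -- ### the inclusion `LateReturns(S, R, V′) ⊆ B n₀`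
  have hV'1 : ContDiff ℝ 1 V' := hV'.of_le (by norm_num)
  have hW'eq : ∀ z : EuclideanSpace ℝ (Fin 3), ‖z‖ < Rbig → selfSimilarTransport γ 0 V' z = W z := by
    intro z hz
    simp only [hWdef, selfSimilarTransport_apply, hagree' z (by rwa [mem_ball, dist_zero_right])]
  set m : ℕ := ⌈2 * R⌉₊ with hmdef
  have h2Rm : 2 * R ≤ (m : ℝ) := Nat.le_ceil _
  have hincl : ball x₀ r ∩ {y | ∃ σ : ℝ, S ≤ σ ∧
      (∀ σ' ∈ Set.Icc 0 σ, ‖ODE.evolutionMap (fun _ : ℝ => selfSimilarTransport γ 0 V') 0 (-σ') y‖ ≤ 2 * R) ∧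
      ‖ODE.evolutionMap (fun _ : ℝ => selfSimilarTransport γ 0 V') 0 (-σ) y‖ < R₁} ⊆ Bn n₀ := by
    rintro y ⟨hyB, σ, hSσ, hstay, hret⟩
    refine ⟨hyB, ?_⟩
    set Z : ℝ → EuclideanSpace ℝ (Fin 3) := fun t => ODE.evolutionMap (fun _ : ℝ => selfSimilarTransport γ 0 V') 0 (-t) y with hZdef
    have hZd : ∀ t, HasDerivAt Z ((-1 : ℝ) • selfSimilarTransport γ 0 V' (Z t)) t :=
      fun t => C2.Kelvin.hasDerivAt_flow_neg (γ := γ) hV'1 hK' y t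
    have hZ0 : Z 0 = y := by simp [hZdef, ODE.evolutionMap_self]
    have hσδ : δ ≤ σ := by
      have : (0 : ℝ) ≤ n₀ := Nat.cast_nonneg n₀
      linarith
    have hZtrue : ∀ s ∈ Icc 0 σ, HasDerivAt Z (-(W (Z s))) s := by
      intro s hs
      have hd := hZd s
      rw [neg_one_smul, hW'eq _ (by linarith [hstay s hs])] at hd
      exact hd
    have hZm : ∀ s ∈ Icc 0 σ, HasDerivAt Z (-(selfSimilarTransport γ 0 (Vc m) (Z s))) s := by
      intro s hs
      have hd := hZtrue s hs
      rw [← hWm_eq m _ (by linarith [hstay s hs])] at hd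
      exact hd
    have hEq : EqOn (Arc m y) Z (Icc 0 σ) :=
      eqOn_arcs_of_cutoff (hVc1 m) (hKc m) (fun s _ => hArc_self m y s) hZm (by rw [hArc0, hZ0])
    -- the window before the return
    have hwin := norm_le_of_return_window hWc hv hvδ hσδ hZtrue hret
    obtain ⟨q, hq1, hq2⟩ := exists_rat_btwn (show σ - δ < σ by linarith)
    have hq0 : (0 : ℝ) ≤ (q : ℝ) := by
      have : (0 : ℝ) ≤ n₀ := Nat.cast_nonneg n₀
      linarith
    refine ⟨m, q, by linarith, fun s hs => ?_, ?_⟩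
    · have hs' : s ∈ Icc 0 σ := ⟨hs.1, hs.2.trans hq2.le⟩
      rw [hEq hs']
      exact (hstay s hs').trans h2Rm
    · have hq' : (q : ℝ) ∈ Icc 0 σ := ⟨hq0, hq2.le⟩
      rw [hEq hq']
      exact hwin q ⟨hq1.le, hq2.le⟩
  -- ### conclusion
  have hle := (measure_mono (μ := volume) hincl).trans hn₀
  have hne : ENNReal.ofReal ε * volume (ball x₀ r) ≠ ∞ := ENNReal.mul_ne_top ENNReal.ofReal_ne_top hvtop.ne
  have hfin := ENNReal.toReal_mono hne hle
  rwa [ENNReal.toReal_mul, ENNReal.toReal_ofReal hε.le] at hfin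

end LastExit

end Summit.NavierStokesRegularity.NavierStokesRegularity.Theorems.PowerGaugeEulerLiouville

end
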